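import Summits.ABC.IUTFork.Cor312Statement
import Summits.ABC.IUTFork.Cor312Bridge
import HarnessLib

/-!
# The fork at [IUTchIII] Corollary 3.12 — the VERBATIM STATEMENT (c312-7) as a skeleton `Cor312Setting`

Record-only file (D-0012) of the abc-iut cell (Cor. 3.12 sub-crew, wave 2, seat abc-iut-c312-6, board row W2-C);
TAKES NO SIDE. Seat c312-7's `Cor312Statement` types the printed statement of [IUTchIII] Cor. 3.12 (kurims
`paper:url-4b091feeb646` p. 173 l. 41 – p. 174 l. 19) over c312-1's `Thm311.Situation`: a `Cor312.Setting P` carries,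
per packet `𝓘^ℚ(^{S^±_{j+1}};^{n,∘}𝒟^⊢_{v_ℚ})`, the admissible regions and mono-analytic log-volume of Thm. 3.11 (i) (a), a hull
frame (Rmk. 3.9.5 (i)/(ii)), the possible images of the Θ-pilot object and the image of the `q`-pilot object
(Def. 3.8 (i), Thm. 3.11 (i)(ii), (Ind1)(Ind2)(Ind3)), and the two printed numbers `negLogTheta : WithTop ℝ`,
`negLogQ : ℝ` with `Statement := negLogTheta ≠ ⊤ ∧ ↑negLogQ ≤ negLogTheta`. The fork skeleton (XVII `ForkRegions`)
states the Corollary over a `Cor312Setting`. THIS file maps the former to the latter: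

* `toLocalFamily` — the packets of `P` at the labels `j ∈ 𝔽_l^⋇` and all `v_ℚ`, as a `Cor312Vol.LocalFamily`
  (weights `1/l⋇`, hull = c312-7's `HullFrame.hullClosure`), under the ONE named hypothesis the signature does
  not carry: `LogvolMono P` — the log-volume of Thm. 3.11 (i) (a) is monotone on admissible regions ([IUTchIII]
  Prop. 3.9 (i): a weighted sum of logarithms of measures; a THEOREM in the real container,
  `Cor312Vol.packetLogvolE_mono`).
* `toCor312Setting` — the skeleton setting: possible images = GLOBAL choices `λ = (U_{j,v_ℚ})` of a possible
  image in every packet (read as the box `Π U_{j,v_ℚ}`), `Q` = the box of the `q`-pilot images; its data fields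
  `U_adm`, `Uhol_adm`, `Q_adm` are supplied by `H : BridgeHyps P` (admissibility of possible images, nonemptiness of
  hull-sets and of the Θ-pilot's Kummer images, and c312-7's `ThetaFinite` = the Corollary's "`−|log(Θ)| ∈ ℝ`").
* `toCor312Setting_negLogTheta` / `_negAbsLogq`: the skeleton's `−|log(Θ)|`, `−|log(q)|` ARE c312-7's, by the
  bookkeeping `Cor312Vol.finsum_eq_processionNormalized`; hence **`statement_iff_cor312`**:
  `P.Statement ↔ (toCor312Setting H).Cor312`. Consequently every skeleton theorem (`logvol_U_le_negLogTheta`, the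
  readings `RepresentedVol`/`QSubHull`/`QIsImage` ⟹ `Cor312`, `readings_differ`; c312-2's `Volumes.ofSetting` ⟹
  `RealEdges`; XVIII's inflation calculus once filed) applies to the verbatim statement, and
  `Cor312Vol.cor312_iff_of_agreement` carries it to the Dupuy–Hilado form (c312-3).

Sources read on the page: [IUTchIII] pp. 173–175 (statement; proof p. 174 l. 50 – p. 175 l. 4 for the per-packet
hulls `^{n,∘}𝒰_{j,v_ℚ}` and "the quantity `−|log(Θ)|` is finite"). [claim: Mochizuki2012, status: disputed]
Deliberately NOT here: any construction of the glue maps (c312-7 R1/R2, c312-1), any judgement.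
-/

noncomputable section

open Set
open scoped ENNReal

namespace Summit.ABC

namespace IUTFork

namespace Cor312Vol

open Thm311 Cor312 Literature.IUT.LogThetaLattice

variable {T : ThetaIndex} {S : Situation T} (P : Cor312.Setting S)

/-! ## 1. The one hypothesis the signature lacks; the packets as a local family -/

/-- **Monotonicity of the mono-analytic log-volume** of Thm. 3.11 (i) (a) on admissible regions, at the labels
`j ∈ 𝔽_l^⋇` ([IUTchIII] Prop. 3.9 (i): log-volumes are weighted sums of logarithms of Haar measures — monotone;
PROVED for the real container as `Cor312Vol.packetLogvolE_mono`; c312-1's signature `MRData` does not carry it).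
HYPOTHESIS. [claim: Mochizuki2012, status: disputed] -/
@[claim "Mochizuki2012" "disputed"]
def LogvolMono : Prop :=
  ∀ (i : Fin T.lstar) (vQ : T.VQ) ⦃A B : Set (S.L.Packet (Setting.labelSucc i) vQ)⦄,
    (S.D P.n).Adm _ vQ A → (S.D P.n).Adm _ vQ B → A ⊆ B →
      (S.D P.n).logvol _ vQ A ≤ (S.D P.n).logvol _ vQ B

/-- The packets of the verbatim setting at the labels `j ∈ 𝔽_l^⋇` (index `t = (i, v_ℚ)`, `j = i+1`) as a family of
local volume containers with weights `1/l⋇` and c312-7's hull closure operator. [claim: Mochizuki2012, status: disputed] -/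
abbrev toLocalFamily (hmono : LogvolMono P) : LocalFamily where
  T := Fin T.lstar × T.VQ
  c := fun _ => 1 / (T.lstar : ℝ)
  c_nonneg := fun _ => by positivity
  C := fun t =>
    { L := S.L.Packet (Setting.labelSucc t.1) t.2
      Adm := (S.D P.n).Adm _ t.2
      logvol := (S.D P.n).logvol _ t.2
      logvol_mono := fun _ _ hA hB hAB => hmono t.1 t.2 hA hB hAB
      hull := (P.frame _ t.2).hullClosure }

/-- A GLOBAL possible image: a choice of a possible image of the Θ-pilot object in every packet
(`Setting.possibleImages`, indexed by `t = (i, v_ℚ)`). [claim: Mochizuki2012, status: disputed] -/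
def ImageChoice : Type :=
  {U : ∀ t : Fin T.lstar × T.VQ, Set (S.L.Packet (Setting.labelSucc t.1) t.2) //
    ∀ t, U t ∈ P.possibleImages (Setting.labelSucc t.1) t.2}

/-- Global choices EXIST (no vacuous index type): the (Ind3)-enlarged region is a possible image in every packet.
[folklore] -/
theorem imageChoice_nonempty : Nonempty (ImageChoice P) :=
  ⟨⟨fun t => P.thetaRegion3 _ t.2, fun t => P.thetaRegion3_mem_possibleImages _ t.2⟩⟩

/-- **The hypotheses under which the verbatim setting fills the skeleton's `Cor312Setting`** (each a printed
assertion of the Corollary or its proof, or a property of the real container): monotone log-volume; every possible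
image admissible (proof of Cor. 3.12, p. 175 l. 2–4: compactness of the `^{n,∘}𝒰_{j,v_ℚ}`) with log-volume finitely
supported over `(j, v_ℚ)` (Prop. 3.9 (iii)); hull-sets nonempty (`λ·𝒪 ∋ 0`); the Θ-pilot's (Ind3)-enlarged Kummer
image nonempty in every packet; c312-7's `ThetaFinite` ("the quantity `−|log(Θ)|` is finite": every packet union admits its hull, `HullDefined`). HYPOTHESIS structure.
[claim: Mochizuki2012, status: disputed] -/
structure BridgeHyps : Prop where
  /-- monotone log-volume -/
  mono : LogvolMono P
  /-- possible images are admissible … -/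
  image_adm : ∀ (i : Fin T.lstar) (vQ : T.VQ), ∀ U ∈ P.possibleImages (Setting.labelSucc i) vQ,
    (S.D P.n).Adm _ vQ U
  /-- … with finitely supported weighted log-volume along every global choice -/
  image_fin : ∀ U : ImageChoice P,
    (Function.support fun t : Fin T.lstar × T.VQ =>
      (1 / (T.lstar : ℝ)) * (S.D P.n).logvol _ t.2 (U.1 t)).Finite
  /-- hull-sets are nonempty -/
  hul_nonempty : ∀ (j : T.Label) (vQ : T.VQ), ∀ H ∈ (P.frame j vQ).Hul, H.Nonempty
  /-- the (Ind3)-enlarged Θ-pilot region is nonempty in every packet -/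
  theta_nonempty : ∀ (i : Fin T.lstar) (vQ : T.VQ), (P.thetaRegion3 (Setting.labelSucc i) vQ).Nonempty
  /-- "`−|log(Θ)|` is finite" -/
  finite : P.ThetaFinite

variable {P}

/-- Every possible image is nonempty (it is a translate of the nonempty (Ind3)-enlarged region). [folklore] -/
theorem possibleImages_nonempty (H : BridgeHyps P) (i : Fin T.lstar) (vQ : T.VQ)
    {U : Set (S.L.Packet (Setting.labelSucc i) vQ)} (hU : U ∈ P.possibleImages (Setting.labelSucc i) vQ) :
    U.Nonempty := by
  obtain ⟨Φ, -, rfl⟩ := hU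
  exact (H.theta_nonempty i vQ).image _

/-- Under `ThetaFinite`, every union of possible images at a label in `𝔽_l^⋇` admits its holomorphic hull
(c312-7's `HullDefined`: relatively compact and non-degenerate). [folklore] -/
theorem hullDefined_of_finite (H : BridgeHyps P) (i : Fin T.lstar) (vQ : T.VQ) :
    P.HullDefined (Setting.labelSucc i) vQ := by
  by_contra hb
  exact H.finite.1 i vQ (by unfold Setting.thetaLocal; rw [if_neg hb])

/-- Under `ThetaFinite`, c312-7's local term `thetaLocal` is the real log-volume of the packet hull. [folklore] -/
theorem thetaLocal_untopD (H : BridgeHyps P) (i : Fin T.lstar) (vQ : T.VQ) :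
    (P.thetaLocal (Setting.labelSucc i) vQ).untopD 0 =
      (S.D P.n).logvol _ vQ (P.thetaHull (Setting.labelSucc i) vQ) := by
  unfold Setting.thetaLocal
  rw [if_pos (hullDefined_of_finite H i vQ)]
  rfl

/-- The packet hulls `^{n,∘}𝒰_{j,v_ℚ}` are nonempty. [folklore] -/
theorem thetaHull_nonempty (H : BridgeHyps P) (t : Fin T.lstar × T.VQ) :
    (P.thetaHull (Setting.labelSucc t.1) t.2).Nonempty :=
  (possibleImages_nonempty H _ _ (P.thetaRegion3_mem_possibleImages _ t.2)).mono
    ((Set.subset_sUnion_of_mem (P.thetaRegion3_mem_possibleImages _ t.2)).trans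
      ((P.frame _ t.2).subset_hull _))

/-- The projection to the packet `t` of the union of the global possible images is the union of the possible
images in that packet. [folklore] -/
theorem eval_image_iUnion_imageChoice (H : BridgeHyps P) (t : Fin T.lstar × T.VQ) :
    (fun x : (∀ t' : Fin T.lstar × T.VQ, S.L.Packet (Setting.labelSucc t'.1) t'.2) => x t) ''
        (⋃ U : ImageChoice P, Set.univ.pi U.1) =
      ⋃₀ P.possibleImages (Setting.labelSucc t.1) t.2 := by
  classical
  apply Set.Subset.antisymm
  · rintro _ ⟨x, hx, rfl⟩
    obtain ⟨U, hU⟩ := Set.mem_iUnion.mp hx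
    exact ⟨U.1 t, U.2 t, hU t (Set.mem_univ t)⟩
  · rintro y ⟨V, hV, hy⟩
    -- the global choice: `V` at `t`, the (Ind3)-enlarged region elsewhere
    let U : ImageChoice P := ⟨fun t' => if h : t' = t then h ▸ V else P.thetaRegion3 _ t'.2,
      fun t' => by
        by_cases h : t' = t
        · subst h; simpa using hV
        · simpa [h] using P.thetaRegion3_mem_possibleImages _ t'.2⟩
    have hne : ∀ t', (U.1 t').Nonempty := fun t' => possibleImages_nonempty H _ _ (U.2 t')
    choose z hz using hne
    refine ⟨fun t' => if h : t' = t then h ▸ y else z t', Set.mem_iUnion.mpr ⟨U, fun t' _ => ?_⟩, by simp⟩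
    by_cases h : t' = t
    · subst h; simpa [U] using hy
    · simpa [h, U] using hz t'

/-- The assembled hull of the union of the global possible images is the box of the packet hulls
`^{n,∘}𝒰_{j,v_ℚ}` (proof of Cor. 3.12, p. 174 l. 50–58: hulls are formed per `(j, v_ℚ)`). [folklore] -/
theorem assemble_hull_iUnion (H : BridgeHyps P) :
    (toLocalFamily P H.mono).assemble.hull (⋃ U : ImageChoice P, Set.univ.pi U.1) =
      Set.univ.pi fun t : Fin T.lstar × T.VQ => P.thetaHull (Setting.labelSucc t.1) t.2 := by
  rw [LocalFamily.assemble_hull_apply]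
  refine congrArg _ (funext fun t => ?_)
  exact congrArg (P.frame (Setting.labelSucc t.1) t.2).hull (eval_image_iUnion_imageChoice H t)

/-- The log-volumes of the packet hulls are finitely supported over `(j, v_ℚ)` (from `ThetaFinite`). [folklore] -/
theorem thetaHull_support_finite (H : BridgeHyps P) :
    (Function.support fun t : Fin T.lstar × T.VQ =>
      (1 / (T.lstar : ℝ)) * (S.D P.n).logvol _ t.2 (P.thetaHull (Setting.labelSucc t.1) t.2)).Finite :=
  support_finite_of_labels (f := fun t : Fin T.lstar × T.VQ =>
      (S.D P.n).logvol _ t.2 (P.thetaHull (Setting.labelSucc t.1) t.2)) _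
    fun i => by simpa only [thetaLocal_untopD H] using H.finite.2 i

/-! ## 2. The verbatim setting as a skeleton `Cor312Setting` -/

/-- **The verbatim statement's setting as a skeleton `Cor312Setting`**: container = the assembled packets of `P`
(labels `𝔽_l^⋇`, weights `1/l⋇`, c312-7's hulls); possible images = the boxes of the global choices; `Q` = the box of
the `q`-pilot images. [claim: Mochizuki2012, status: disputed] -/
def toCor312Setting (H : BridgeHyps P) : Cor312Setting :=
  verbatimSetting (toLocalFamily P H.mono) (Idx := ImageChoice P) (fun U => Set.univ.pi U.1)
    (fun U => ⟨U.1, rfl, fun t => ⟨possibleImages_nonempty H _ _ (U.2 t), H.image_adm _ _ _ (U.2 t)⟩,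
      H.image_fin U⟩)
    (by
      rw [assemble_hull_iUnion H]
      exact ⟨fun t => P.thetaHull (Setting.labelSucc t.1) t.2, rfl,
        fun t => ⟨thetaHull_nonempty H t, P.thetaHull_adm (hullDefined_of_finite H t.1 t.2)⟩,
        thetaHull_support_finite H⟩)
    (Set.univ.pi fun t => P.qRegion (Setting.labelSucc t.1) t.2)
    ⟨fun t => P.qRegion (Setting.labelSucc t.1) t.2, rfl,
      fun t => ⟨H.hul_nonempty _ _ _ (P.qRegion_mem _ t.2), P.hul_adm _ t.2 _ (P.qRegion_mem _ t.2)⟩,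
      support_finite_of_labels (f := fun t : Fin T.lstar × T.VQ =>
          (S.D P.n).logvol _ t.2 (P.qRegion (Setting.labelSucc t.1) t.2)) _
        fun i => P.qSupport_finite _⟩

/-! ## 3. The two numbers agree; the statement is the skeleton's `Cor312` -/

/-- **The skeleton's `−|log(Θ)|` of the verbatim setting IS c312-7's `negLogTheta`** (both = `(1/l⋇) Σ_j Σᶠ_{v_ℚ}`
log-volume of the packet hull of the union of the possible images; [IUTchIII] Cor. 3.12 p. 173, Prop. 3.9 (i)(iii)).
[claim: Mochizuki2012, status: disputed] -/
theorem toCor312Setting_negLogTheta (H : BridgeHyps P) :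
    (((toCor312Setting H).negLogTheta : ℝ) : WithTop ℝ) = P.negLogTheta := by
  unfold Setting.negLogTheta
  rw [if_pos H.finite]
  congr 1
  show (toLocalFamily P H.mono).assemble.logvol
      ((toLocalFamily P H.mono).assemble.hull (⋃ U : ImageChoice P, Set.univ.pi U.1)) = _
  rw [assemble_hull_iUnion H, LocalFamily.assemble_logvol_pi _ _ (thetaHull_nonempty H)]
  rw [finsum_eq_processionNormalized
    (fun t : Fin T.lstar × T.VQ => (S.D P.n).logvol _ t.2 (P.thetaHull (Setting.labelSucc t.1) t.2))
    (fun i => by simpa only [thetaLocal_untopD H] using H.finite.2 i)]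
  simp only [thetaLocal_untopD H]

/-- **The skeleton's `−|log(q)|` of the verbatim setting IS c312-7's `negLogQ`.** [claim: Mochizuki2012, status: disputed] -/
theorem toCor312Setting_negAbsLogq (H : BridgeHyps P) : (toCor312Setting H).negAbsLogq = P.negLogQ := by
  show (toLocalFamily P H.mono).assemble.logvol
      (Set.univ.pi fun t : Fin T.lstar × T.VQ => P.qRegion (Setting.labelSucc t.1) t.2) = _
  rw [LocalFamily.assemble_logvol_pi _ _ (fun t : Fin T.lstar × T.VQ =>
    H.hul_nonempty _ _ _ (P.qRegion_mem (Setting.labelSucc t.1) t.2))]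
  exact finsum_eq_processionNormalized
    (fun t : Fin T.lstar × T.VQ => (S.D P.n).logvol _ t.2 (P.qRegion (Setting.labelSucc t.1) t.2))
    (fun i => P.qSupport_finite _)

/-- **THE BRIDGE: c312-7's verbatim `Statement` ↔ the skeleton's `Cor312` of the verbatim setting** (under the
hypotheses `H`, which include the Statement's own first clause "`−|log(Θ)| ∈ ℝ`"). Hence the skeleton's readings,
c312-2's `Volumes.ofSetting`/`RealEdges`, and (via `cor312_iff_of_agreement`) the Dupuy–Hilado form all speak about
the printed statement. [claim: Mochizuki2012, status: disputed] -/
theorem statement_iff_cor312 (H : BridgeHyps P) : P.Statement ↔ (toCor312Setting H).Cor312 := by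
  unfold Setting.Statement Cor312Setting.Cor312
  rw [← toCor312Setting_negLogTheta H, toCor312Setting_negAbsLogq H]
  simp only [ne_eq, WithTop.coe_ne_top, not_false_eq_true, true_and, WithTop.coe_le_coe]

/-! ## 4. The three readings of Step (xi) as edges INTO the printed statement (none asserted) -/

/-- READING 3 in c312-7's vocabulary ([IUTchIII] p. 184 (xi-f)/(xi-g), Fig. 3.8 "two tautologically equivalent
ways to compute the log-volume of the q-pilot object"; LANA §8.1 (a); Rmk. 3.11.1 (iii) (IPL)): "the `q`-pilot image
IS a possible image of the Θ-pilot object" in every packet ⟹ the skeleton's `QIsImage` for the verbatim setting,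
hence `Cor312`, hence the printed `Statement`. The content is the hypothesis; nothing is asserted.
[claim: Mochizuki2012, status: disputed] -/
theorem statement_of_qRegion_mem_possibleImages (H : BridgeHyps P)
    (h : ∀ (i : Fin T.lstar) (vQ : T.VQ), P.qRegion (Setting.labelSucc i) vQ ∈ P.possibleImages _ vQ) :
    P.Statement :=
  (statement_iff_cor312 H).mpr
    ((toCor312Setting H).cor312_of_qSubHull
      ((toCor312Setting H).qSubHull_of_qIsImage ⟨⟨fun t => P.qRegion _ t.2, fun t => h t.1 t.2⟩, rfl⟩))

/-- READING 2 in c312-7's vocabulary ("`−|log(q)| ∈ ℝ_{≤−|log(Θ)|}`" read one level down, LANA §8.3 p. 43): the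
`q`-pilot image lies in the packet hull `^{n,∘}𝒰_{j,v_ℚ}` of the possible images in every packet ⟹ the skeleton's
`QSubHull`, hence the printed `Statement` (monotonicity of the log-volume). Hypothesis, not asserted.
[claim: Mochizuki2012, status: disputed] -/
theorem statement_of_qRegion_subset_thetaHull (H : BridgeHyps P)
    (h : ∀ (i : Fin T.lstar) (vQ : T.VQ), P.qRegion (Setting.labelSucc i) vQ ⊆ P.thetaHull _ vQ) :
    P.Statement := by
  refine (statement_iff_cor312 H).mpr ((toCor312Setting H).cor312_of_qSubHull ?_)
  show (Set.univ.pi fun t : Fin T.lstar × T.VQ => P.qRegion (Setting.labelSucc t.1) t.2) ⊆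
    (toLocalFamily P H.mono).assemble.hull (⋃ U : ImageChoice P, Set.univ.pi U.1)
  rw [assemble_hull_iUnion H]
  exact Set.pi_mono fun t _ => h t.1 t.2

/-- READING 1 in c312-7's vocabulary (LANA §8.3 p. 43 "the set of procession-normalized log-volumes of the
admissible output regions contains the `q`-pilot log-volume as one of its possible values"; §9.3 (9-1) at volume
level): some GLOBAL choice of possible images has assembled log-volume `−|log(q)|` ⟹ the skeleton's
`RepresentedVol`, hence the printed `Statement`. Hypothesis, not asserted. [cite: LANA2026Report, §8.3 p. 43] -/
theorem statement_of_represented (H : BridgeHyps P)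
    (h : ∃ U : ImageChoice P, (toLocalFamily P H.mono).assemble.logvol (Set.univ.pi U.1) = P.negLogQ) :
    P.Statement := by
  refine (statement_iff_cor312 H).mpr ((toCor312Setting H).cor312_of_representedVol ?_)
  obtain ⟨U, hU⟩ := h
  exact ⟨U, hU.trans (toCor312Setting_negAbsLogq H).symm⟩

/-- LANA's MAIN GOAL (9-1) for the `η`-setting carried by the verbatim setting (any pointed line `ℝ^val`) is
READING 1 (`ForkRegions.Cor312Setting.mainGoal_iff_representedVol`) — so (9-1) ⟹ the printed `Statement`.
Hypothesis, not asserted. [cite: LANA2026Report, §9.2 (9-1) p. 46] -/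
theorem statement_of_mainGoal (H : BridgeHyps P) (Rval : PointedLine)
    (h : ((toCor312Setting H).toEtaSetting Rval).MainGoal) : P.Statement :=
  (statement_iff_cor312 H).mpr
    ((toCor312Setting H).cor312_of_representedVol
      (((toCor312Setting H).mainGoal_iff_representedVol Rval).mp h))

-- The converse edges are ABSENT: at the skeleton's level the inequality forces no reading —
-- `ForkRegions.readings_differ` (a setting with `Cor312` true and Readings 1, 2 false); not restated here.

/-- Every possible image (along any global choice) has assembled log-volume `≤` c312-7's `−|log(Θ)|` — the
skeleton's `logvol_U_le_negLogTheta` read back in the verbatim vocabulary. [folklore] -/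
theorem logvol_imageChoice_le_negLogTheta (H : BridgeHyps P) (U : ImageChoice P) :
    (((toLocalFamily P H.mono).assemble.logvol (Set.univ.pi U.1) : ℝ) : WithTop ℝ) ≤ P.negLogTheta := by
  rw [← toCor312Setting_negLogTheta H]
  exact WithTop.coe_le_coe.mpr ((toCor312Setting H).logvol_U_le_negLogTheta U)

end Cor312Vol

end IUTFork

end Summit.ABC

end
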